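import Literature.NumberTheory.Irrationality.Tosi2026.CyclicSymmetry
import Literature.Analysis.SpecialFunctions.ArcsinPowerSeries
import Mathlib.Analysis.SpecialFunctions.Trigonometric.Arctan
import HarnessLib

/-!
# Tosi 2026, Theorem 1 — PROOF (`theorem1_holds`)

R. Tosi, *An explicit study of a family of cellular integrals*, arXiv:2601.00346 [Tosi2026], Theorem 1
(p. 2): for the basic cellular integrals `ξ_l = ∫_{(0,1)^l} dx/((1 − x₁x₂)⋯(1 − x_{l−1}x_l))` (`xi`),
(i) `1 + Σ_{n≥1} ξ_{2n} tⁿ = arcsin(π√t)/(π√t)`, (ii) `ξ_{2m+1} = Σ_{h=0}^{m} ξ_{2h} ξ_{2m−2h}`,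
(iii) `ξ_{2m} = (2m)!/(4^m (m!)² (2m+1)) · π^{2m}`. This file DISCHARGES the named fact
`Literature.NumberTheory.Irrationality.Tosi2026.theorem1` of `BasicCellularIntegrals.lean`.

## The proof (ours; the paper proceeds through hyperlogarithm primitives, a recurrence (§2.3) and [Hof17])

From `SechChainCoordinates.lean` and `CyclicSymmetry.lean`: with `f_k = sech^{*(k+1)}`,
`(l+1) · ξ_l = f_l(0) = π^{l−1} ∫_ℝ sech^{l+1}` for EVERY `l` (`xi_eq_sechConv_div`), hence ONE formula
for all `l`, even and odd (`xi_even`, `xi_odd`):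

`ξ_{2m} = π^{2m} P_m/(2m+1)`, `ξ_{2m+1} = π^{2m} Q_m/(m+1)`, `P_m = ∏_{i<m} (2i+1)/(2i+2) = (2m)!/(4^m m!²)`,
`Q_m = ∏_{i<m} (2i+2)/(2i+3) = 4^m m!²/(2m+1)!`

(so also `ξ_{2m+1} = 2·4^m m!² π^{2m}/(2m+2)!`, not displayed in the source). Clause (iii) is the even case;
clause (ii) is the convolution identity `Σ_{i+j=m} P_i P_j/((2i+1)(2j+1)) = Q_m/(m+1)`
(`sum_antidiagonal_evenCoeff_mul`, from `Σ_{i+j=m} P_i P_j = 1` and `Σ_{i+j=m} P_i P_j/(2i+1) = Q_m`, proved by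
the coefficient form of `2(1−X)B′ = B`, `B² = (1−X)⁻¹` for `B = Σ P_m X^m`); clause (i) then follows from
(ii) and Euler's series for `arcsin²` (tree: `Literature.Analysis.SpecialFunctions.hasSum_arcsin_sq`):
the even generating function `E` satisfies `E² = arcsin²(y)/y²` with `E ≥ 0`.
-/

noncomputable section

open MeasureTheory Set Finset Real
open scoped ENNReal
open Literature.Analysis.SpecialFunctions

namespace Literature.NumberTheory.Irrationality.Tosi2026

/-! ### `ξ_l = f_l(0)/(l+1)` -/

/-- **`ξ_{n+1} = f_{n+1}(0)/(n+2)`**, `f_k = sech^{*(k+1)}` (change of variables + cyclic symmetry +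
collapse of the chain). [cite: Tosi2026, Theorem 1 (p. 2)] -/
theorem xi_succ_eq_sechConv (n : ℕ) : xi (n + 1) = sechConv (n + 1) 0 / ((n : ℝ) + 2) := by
  have hR := xi_succ_eq_lintegral_posOrthant n
  have hU := lintegral_cycleDensity n
  have hS := lintegral_cycleDensity_eq_mul_posOrthant n
  set I₀ := ∫⁻ a in posOrthant n, ENNReal.ofReal (cycleDensity n a) with hI₀
  have hne : ((n : ℝ≥0∞) + 2) ≠ 0 := by positivity
  have hnt : ((n : ℝ≥0∞) + 2) ≠ ⊤ := by simp
  have hI : I₀ = ENNReal.ofReal (sechConv (n + 1) 0) / ((n : ℝ≥0∞) + 2) := by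
    rw [ENNReal.eq_div_iff hne hnt, ← hS, hU]
  rw [hR, hI, ENNReal.toReal_div, ENNReal.toReal_ofReal (sechConv_nonneg _ _)]
  have hc : ((n : ℝ≥0∞) + 2).toReal = (n : ℝ) + 2 := by
    have e2 : ((n : ℝ≥0∞) + 2) = ((n + 2 : ℕ) : ℝ≥0∞) := by norm_cast
    rw [e2, ENNReal.toReal_natCast]
    norm_cast
  rw [hc]

/-- **`ξ_l = f_l(0)/(l+1)` for every `l ≥ 0`** (`ξ₀ = 1 = sech 0`). [cite: Tosi2026, Theorem 1 (p. 2)] -/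
theorem xi_eq_sechConv_div (l : ℕ) : xi l = sechConv l 0 / ((l : ℝ) + 1) := by
  rcases l with _ | n
  · simp [xi_zero, sech_zero]
  · rw [xi_succ_eq_sechConv]; push_cast; ring

/-! ### The Wallis-type products `P_m`, `Q_m` -/

/-- `P_m = ∏_{i<m} (2i+1)/(2i+2)` (`= (2m)!/(4^m m!²) = binom(2m,m)/4^m`). [cite: Tosi2026, Theorem 1 (p. 2)] -/
def oddOverEven (m : ℕ) : ℝ := ∏ i ∈ range m, ((2 * i + 1 : ℝ) / (2 * i + 2))

/-- `Q_m = ∏_{i<m} (2i+2)/(2i+3)` (`= 4^m m!²/(2m+1)!`). [cite: Tosi2026, Theorem 1 (p. 2)] -/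
def evenOverOdd (m : ℕ) : ℝ := ∏ i ∈ range m, ((2 * i + 2 : ℝ) / (2 * i + 3))

/-- `P₀ = 1`. [cite: Tosi2026, Theorem 1 (p. 2)] -/
@[simp] theorem oddOverEven_zero : oddOverEven 0 = 1 := by simp [oddOverEven]

/-- `Q₀ = 1`. [cite: Tosi2026, Theorem 1 (p. 2)] -/
@[simp] theorem evenOverOdd_zero : evenOverOdd 0 = 1 := by simp [evenOverOdd]

/-- `P_{m+1} = P_m (2m+1)/(2m+2)`. [cite: Tosi2026, Theorem 1 (p. 2)] -/
theorem oddOverEven_succ (m : ℕ) : oddOverEven (m + 1) = oddOverEven m * ((2 * m + 1 : ℝ) / (2 * m + 2)) := by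
  unfold oddOverEven; rw [prod_range_succ]

/-- `Q_{m+1} = Q_m (2m+2)/(2m+3)`. [cite: Tosi2026, Theorem 1 (p. 2)] -/
theorem evenOverOdd_succ (m : ℕ) : evenOverOdd (m + 1) = evenOverOdd m * ((2 * m + 2 : ℝ) / (2 * m + 3)) := by
  unfold evenOverOdd; rw [prod_range_succ]

/-- `(2m+2) P_{m+1} = (2m+1) P_m`. [cite: Tosi2026, Theorem 1 (p. 2)] -/
theorem oddOverEven_succ_mul (m : ℕ) : (2 * m + 2 : ℝ) * oddOverEven (m + 1) = (2 * m + 1) * oddOverEven m := by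
  rw [oddOverEven_succ]
  have : (2 * m + 2 : ℝ) ≠ 0 := by positivity
  field_simp

/-- `(2m+3) Q_{m+1} = (2m+2) Q_m`. [cite: Tosi2026, Theorem 1 (p. 2)] -/
theorem evenOverOdd_succ_mul (m : ℕ) : (2 * m + 3 : ℝ) * evenOverOdd (m + 1) = (2 * m + 2) * evenOverOdd m := by
  rw [evenOverOdd_succ]
  have : (2 * m + 3 : ℝ) ≠ 0 := by positivity
  field_simp

/-- `P_m > 0`. [cite: Tosi2026, Theorem 1 (p. 2)] -/
theorem oddOverEven_pos (m : ℕ) : 0 < oddOverEven m :=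
  prod_pos fun i _ => by positivity

/-- `Q_m > 0`. [cite: Tosi2026, Theorem 1 (p. 2)] -/
theorem evenOverOdd_pos (m : ℕ) : 0 < evenOverOdd m :=
  prod_pos fun i _ => by positivity

/-- `P_m ≤ 1`. [cite: Tosi2026, Theorem 1 (p. 2)] -/
theorem oddOverEven_le_one (m : ℕ) : oddOverEven m ≤ 1 :=
  prod_le_one (fun i _ => by positivity) fun i _ => by
    rw [div_le_one (by positivity)]; linarith

/-- `P_m = (2m)!/(4^m m!²)`. [cite: Tosi2026, Theorem 1 (p. 2)] -/
theorem oddOverEven_eq_factorial (m : ℕ) :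
    oddOverEven m = (Nat.factorial (2 * m) : ℝ) / (4 ^ m * (Nat.factorial m : ℝ) ^ 2) := by
  induction m with
  | zero => simp
  | succ m ih =>
      rw [oddOverEven_succ, ih, show 2 * (m + 1) = (2 * m + 1) + 1 by ring, Nat.factorial_succ (2 * m + 1),
        Nat.factorial_succ (2 * m), Nat.factorial_succ m]
      push_cast
      have h1 : ((Nat.factorial m : ℕ) : ℝ) ≠ 0 := by positivity
      field_simp
      ring

/-- `Q_m = 4^m m!²/(2m+1)!`. [cite: Tosi2026, Theorem 1 (p. 2)] -/
theorem evenOverOdd_eq_factorial (m : ℕ) :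
    evenOverOdd m = 4 ^ m * (Nat.factorial m : ℝ) ^ 2 / (Nat.factorial (2 * m + 1) : ℝ) := by
  induction m with
  | zero => simp
  | succ m ih =>
      rw [evenOverOdd_succ, ih, show 2 * (m + 1) + 1 = (2 * m + 2) + 1 by ring, Nat.factorial_succ (2 * m + 2),
        show 2 * m + 2 = (2 * m + 1) + 1 by ring, Nat.factorial_succ (2 * m + 1), Nat.factorial_succ m]
      push_cast
      have h1 : ((Nat.factorial (2 * m + 1) : ℕ) : ℝ) ≠ 0 := by positivity
      field_simp
      ring

/-! ### The closed forms for all `l` -/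

/-- **Even case**: `ξ_{2m} = π^{2m} P_m/(2m+1)`. [cite: Tosi2026, Theorem 1 (p. 2)] -/
theorem xi_even_eq (m : ℕ) : xi (2 * m) = π ^ (2 * m) * oddOverEven m / (2 * m + 1) := by
  rw [xi_eq_sechConv_div, sechConv_apply_zero_even]
  unfold oddOverEven
  push_cast
  ring

/-- **Odd case**: `ξ_{2m+1} = π^{2m} Q_m/(m+1)`. [cite: Tosi2026, Theorem 1 (p. 2)] -/
theorem xi_odd_eq (m : ℕ) : xi (2 * m + 1) = π ^ (2 * m) * evenOverOdd m / (m + 1) := by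
  rw [xi_eq_sechConv_div, sechConv_apply_zero_odd]
  unfold evenOverOdd
  push_cast
  have : ((m : ℝ) + 1) ≠ 0 := by positivity
  field_simp
  ring

/-- **Theorem 1 (iii), for every `m ≥ 0`**: `ξ_{2m} = (2m)!/(4^m (m!)² (2m+1)) · π^{2m}`.
[cite: Tosi2026, Theorem 1 (p. 2)] -/
theorem xi_even (m : ℕ) :
    xi (2 * m) = (Nat.factorial (2 * m) : ℝ) / (4 ^ m * (Nat.factorial m : ℝ) ^ 2 * (2 * m + 1)) * π ^ (2 * m) := by
  rw [xi_even_eq, oddOverEven_eq_factorial]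
  have h1 : ((Nat.factorial m : ℕ) : ℝ) ≠ 0 := by positivity
  field_simp

/-- **The odd integrals in closed form** (not displayed in the source, equivalent to (ii) given (iii)):
`ξ_{2m+1} = 2 · 4^m (m!)² π^{2m}/(2m+2)!`. [cite: Tosi2026, Theorem 1 (p. 2)] -/
theorem xi_odd (m : ℕ) :
    xi (2 * m + 1) = 2 * 4 ^ m * (Nat.factorial m : ℝ) ^ 2 / (Nat.factorial (2 * m + 2) : ℝ) * π ^ (2 * m) := by
  rw [xi_odd_eq, evenOverOdd_eq_factorial, show 2 * m + 2 = 2 * m + 1 + 1 by ring,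
    Nat.factorial_succ (2 * m + 1)]
  push_cast
  have h1 : ((Nat.factorial (2 * m + 1) : ℕ) : ℝ) ≠ 0 := by positivity
  field_simp
  ring

/-- **All `ξ_l` in one formula**: `ξ_l = (2 π^{l−1}/(l+1)) · ∫₀^{π/2} sin^l θ dθ`, here as
`(l+1) ξ_l π = π^l ∫_ℝ sech^{l+1}`. [cite: Tosi2026, Theorem 1 (p. 2)] -/
theorem xi_mul_eq_sechPowIntegral (l : ℕ) :
    ((l : ℝ) + 1) * xi l * π = π ^ l * sechPowIntegral (l + 1) := by
  rw [xi_eq_sechConv_div, sechConv_apply_zero]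
  have hπ : (π : ℝ) ≠ 0 := Real.pi_ne_zero
  have hl : ((l : ℝ) + 1) ≠ 0 := by positivity
  field_simp

/-! ### The convolution identities for `P` and `Q` -/

/-- `Σ_{i+j=m} (i − j)·F(i)F(j)`-type antisymmetric sums vanish: `Σ_{i+j=m} i F_i G_j = Σ_{i+j=m} j G_i F_j`
(swap). [cite: Tosi2026, Theorem 1 (p. 2)] -/
theorem sum_antidiagonal_swap_mul (m : ℕ) (F G : ℕ → ℝ) (w : ℕ → ℝ) :
    ∑ p ∈ antidiagonal m, w p.1 * (F p.1 * G p.2) = ∑ p ∈ antidiagonal m, w p.2 * (G p.1 * F p.2) := by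
  rw [← Nat.sum_antidiagonal_swap]
  refine sum_congr rfl fun p _ => ?_
  simp only [Prod.fst_swap, Prod.snd_swap]
  ring

/-- **`Σ_{i+j=m} P_i P_j = 1`** (the coefficient form of `B² = (1−X)⁻¹` for `B = Σ P_m X^m = (1−X)^{−1/2}`,
via `2(1−X)B′ = B`). [cite: Tosi2026, Theorem 1 (p. 2)] -/
theorem sum_antidiagonal_oddOverEven_mul : ∀ m : ℕ,
    ∑ p ∈ antidiagonal m, oddOverEven p.1 * oddOverEven p.2 = 1
  | 0 => by simp
  | m + 1 => by
      have ih := sum_antidiagonal_oddOverEven_mul m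
      -- `(m+1) R_{m+1} = Σ (i+j) P_i P_j = 2 Σ i P_i P_j`
      have hsym : ∑ p ∈ antidiagonal (m + 1), (p.1 : ℝ) * (oddOverEven p.1 * oddOverEven p.2) =
          ∑ p ∈ antidiagonal (m + 1), (p.2 : ℝ) * (oddOverEven p.1 * oddOverEven p.2) :=
        sum_antidiagonal_swap_mul (m + 1) oddOverEven oddOverEven (fun i => (i : ℝ))
      have htot : ((m : ℝ) + 1) * ∑ p ∈ antidiagonal (m + 1), oddOverEven p.1 * oddOverEven p.2 =
          2 * ∑ p ∈ antidiagonal (m + 1), (p.1 : ℝ) * (oddOverEven p.1 * oddOverEven p.2) := by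
        rw [mul_sum, two_mul]
        nth_rw 2 [hsym]
        rw [← sum_add_distrib]
        refine sum_congr rfl fun p hp => ?_
        have : (p.1 : ℝ) + p.2 = m + 1 := by
          have := mem_antidiagonal.mp hp; exact_mod_cast this
        linear_combination (oddOverEven p.1 * oddOverEven p.2) * this.symm
      -- shift: the `(0, m+1)` term vanishes, `Σ_{AD(m+1)} i P_i P_j = Σ_{AD m} (i+1) P_{i+1} P_j`
      have hshift : ∑ p ∈ antidiagonal (m + 1), (p.1 : ℝ) * (oddOverEven p.1 * oddOverEven p.2) =
          ∑ p ∈ antidiagonal m, ((p.1 : ℝ) + 1) * (oddOverEven (p.1 + 1) * oddOverEven p.2) := by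
        rw [Nat.sum_antidiagonal_succ]
        simp
      -- recursion `(2i+2) P_{i+1} = (2i+1) P_i`
      have hrec : 2 * ∑ p ∈ antidiagonal m, ((p.1 : ℝ) + 1) * (oddOverEven (p.1 + 1) * oddOverEven p.2) =
          ∑ p ∈ antidiagonal m, (2 * (p.1 : ℝ) + 1) * (oddOverEven p.1 * oddOverEven p.2) := by
        rw [mul_sum]
        refine sum_congr rfl fun p _ => ?_
        have := oddOverEven_succ_mul p.1
        linear_combination (oddOverEven p.2) * this
      -- `Σ (2i+1) P_i P_j = Σ (i+j+1) P_i P_j = (m+1) R_m`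
      have hsym' : ∑ p ∈ antidiagonal m, (p.1 : ℝ) * (oddOverEven p.1 * oddOverEven p.2) =
          ∑ p ∈ antidiagonal m, (p.2 : ℝ) * (oddOverEven p.1 * oddOverEven p.2) :=
        sum_antidiagonal_swap_mul m oddOverEven oddOverEven (fun i => (i : ℝ))
      have hfin : ∑ p ∈ antidiagonal m, (2 * (p.1 : ℝ) + 1) * (oddOverEven p.1 * oddOverEven p.2) =
          ((m : ℝ) + 1) * ∑ p ∈ antidiagonal m, oddOverEven p.1 * oddOverEven p.2 := by
        have e : ∑ p ∈ antidiagonal m, (2 * (p.1 : ℝ) + 1) * (oddOverEven p.1 * oddOverEven p.2) =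
            ∑ p ∈ antidiagonal m, (p.1 : ℝ) * (oddOverEven p.1 * oddOverEven p.2) +
            ∑ p ∈ antidiagonal m, (p.2 : ℝ) * (oddOverEven p.1 * oddOverEven p.2) +
            ∑ p ∈ antidiagonal m, oddOverEven p.1 * oddOverEven p.2 := by
          rw [← hsym', ← sum_add_distrib, ← sum_add_distrib]
          refine sum_congr rfl fun p _ => ?_; ring
        rw [e, mul_sum, ← sum_add_distrib, ← sum_add_distrib]
        refine sum_congr rfl fun p hp => ?_
        have : (p.1 : ℝ) + p.2 = m := by
          have := mem_antidiagonal.mp hp; exact_mod_cast this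
        linear_combination (oddOverEven p.1 * oddOverEven p.2) * this
      have hm : ((m : ℝ) + 1) ≠ 0 := by positivity
      have key : ((m : ℝ) + 1) * ∑ p ∈ antidiagonal (m + 1), oddOverEven p.1 * oddOverEven p.2 = (m : ℝ) + 1 := by
        rw [htot, hshift, hrec, hfin, ih, mul_one]
      field_simp at key
      linarith [key]

/-- **`Σ_{i+j=m} P_i P_j/(2i+1) = Q_m`** (coefficient form of `(1−2X)H + 2X(1−X)H′ = 1` for `H = A·B`,
`A = Σ P_m X^m/(2m+1)`). [cite: Tosi2026, Theorem 1 (p. 2)] -/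
theorem sum_antidiagonal_oddOverEven_div_mul : ∀ m : ℕ,
    ∑ p ∈ antidiagonal m, oddOverEven p.1 / (2 * p.1 + 1) * oddOverEven p.2 = evenOverOdd m
  | 0 => by simp
  | m + 1 => by
      have ih := sum_antidiagonal_oddOverEven_div_mul m
      set S := ∑ p ∈ antidiagonal (m + 1), oddOverEven p.1 / (2 * p.1 + 1) * oddOverEven p.2 with hSdef
      -- `(2m+3) S_{m+1} = Σ (2i+1) c_i P_j + Σ 2j c_i P_j = R_{m+1} + 2 Σ j c_i P_j`
      have h1 : (2 * (m : ℝ) + 3) * S =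
          ∑ p ∈ antidiagonal (m + 1), oddOverEven p.1 * oddOverEven p.2 +
          2 * ∑ p ∈ antidiagonal (m + 1), (p.2 : ℝ) * (oddOverEven p.1 / (2 * p.1 + 1) * oddOverEven p.2) := by
        rw [hSdef, mul_sum, mul_sum, ← sum_add_distrib]
        refine sum_congr rfl fun p hp => ?_
        have hsum : (p.1 : ℝ) + p.2 = m + 1 := by
          have := mem_antidiagonal.mp hp; exact_mod_cast this
        have hne : (2 * (p.1 : ℝ) + 1) ≠ 0 := by positivity
        field_simp
        linear_combination (oddOverEven p.1 * oddOverEven p.2) * (2 : ℝ) * hsum.symm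
      -- shift on the second coordinate: `Σ_{AD(m+1)} j c_i P_j = Σ_{AD m} (j+1) c_i P_{j+1}`
      have h2 : ∑ p ∈ antidiagonal (m + 1), (p.2 : ℝ) * (oddOverEven p.1 / (2 * p.1 + 1) * oddOverEven p.2) =
          ∑ p ∈ antidiagonal m, ((p.2 : ℝ) + 1) * (oddOverEven p.1 / (2 * p.1 + 1) * oddOverEven (p.2 + 1)) := by
        rw [Nat.sum_antidiagonal_succ']
        simp
      -- recursion `2 (j+1) P_{j+1} = (2j+1) P_j`
      have h3 : 2 * ∑ p ∈ antidiagonal m, ((p.2 : ℝ) + 1) * (oddOverEven p.1 / (2 * p.1 + 1) * oddOverEven (p.2 + 1)) =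
          ∑ p ∈ antidiagonal m, (2 * (p.2 : ℝ) + 1) * (oddOverEven p.1 / (2 * p.1 + 1) * oddOverEven p.2) := by
        rw [mul_sum]
        refine sum_congr rfl fun p _ => ?_
        have := oddOverEven_succ_mul p.2
        linear_combination (oddOverEven p.1 / (2 * p.1 + 1)) * this
      -- `(2m+2) S_m = R_m + Σ (2j+1) c_i P_j`
      have h4 : (2 * (m : ℝ) + 2) * evenOverOdd m =
          ∑ p ∈ antidiagonal m, oddOverEven p.1 * oddOverEven p.2 +
          ∑ p ∈ antidiagonal m, (2 * (p.2 : ℝ) + 1) * (oddOverEven p.1 / (2 * p.1 + 1) * oddOverEven p.2) := by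
        rw [← ih, mul_sum, ← sum_add_distrib]
        refine sum_congr rfl fun p hp => ?_
        have hsum : (p.1 : ℝ) + p.2 = m := by
          have := mem_antidiagonal.mp hp; exact_mod_cast this
        have hne : (2 * (p.1 : ℝ) + 1) ≠ 0 := by positivity
        field_simp
        linear_combination (oddOverEven p.1 * oddOverEven p.2) * (2 : ℝ) * hsum.symm
      have key : (2 * (m : ℝ) + 3) * S = (2 * (m : ℝ) + 2) * evenOverOdd m := by
        rw [h1, h2, h3, h4, sum_antidiagonal_oddOverEven_mul, sum_antidiagonal_oddOverEven_mul]
      rw [← evenOverOdd_succ_mul] at key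
      have hne : (2 * (m : ℝ) + 3) ≠ 0 := by positivity
      exact mul_left_cancel₀ hne key

/-- **`Σ_{i+j=m} (P_i/(2i+1)) (P_j/(2j+1)) = Q_m/(m+1)`** (partial fractions and the previous identity).
[cite: Tosi2026, Theorem 1 (p. 2)] -/
theorem sum_antidiagonal_evenCoeff_mul (m : ℕ) :
    ∑ p ∈ antidiagonal m, oddOverEven p.1 / (2 * p.1 + 1) * (oddOverEven p.2 / (2 * p.2 + 1)) =
      evenOverOdd m / (m + 1) := by
  have hsym := sum_antidiagonal_swap_mul m (fun i => oddOverEven i / (2 * i + 1)) (fun j => oddOverEven j)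
    (fun _ => 1)
  simp only [one_mul] at hsym
  have h : (2 * (m : ℝ) + 2) * ∑ p ∈ antidiagonal m, oddOverEven p.1 / (2 * p.1 + 1) * (oddOverEven p.2 / (2 * p.2 + 1)) =
      ∑ p ∈ antidiagonal m, oddOverEven p.1 / (2 * p.1 + 1) * oddOverEven p.2 +
      ∑ p ∈ antidiagonal m, oddOverEven p.1 * (oddOverEven p.2 / (2 * p.2 + 1)) := by
    rw [mul_sum, ← sum_add_distrib]
    refine sum_congr rfl fun p hp => ?_
    have hsum : (p.1 : ℝ) + p.2 = m := by
      have := mem_antidiagonal.mp hp; exact_mod_cast this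
    have hne1 : (2 * (p.1 : ℝ) + 1) ≠ 0 := by positivity
    have hne2 : (2 * (p.2 : ℝ) + 1) ≠ 0 := by positivity
    field_simp
    linear_combination (oddOverEven p.1 * oddOverEven p.2) * (2 : ℝ) * hsum.symm
  rw [← hsym, sum_antidiagonal_oddOverEven_div_mul, ← two_mul] at h
  have hne : ((m : ℝ) + 1) ≠ 0 := by positivity
  rw [eq_div_iff hne]
  linarith

/-! ### Theorem 1 -/

/-- **Theorem 1 (iii)**. [cite: Tosi2026, Theorem 1 (p. 2)] -/
theorem theorem1_iii (m : ℕ) (_hm : 1 ≤ m) :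
    xi (2 * m) = (Nat.factorial (2 * m) : ℝ) / (4 ^ m * (Nat.factorial m : ℝ) ^ 2 * (2 * m + 1)) * Real.pi ^ (2 * m) :=
  xi_even m

/-- **Theorem 1 (ii)**: `ξ_{2m+1} = Σ_{h=0}^{m} ξ_{2h} ξ_{2m−2h}` (in fact for every `m ≥ 0`).
[cite: Tosi2026, Theorem 1 (p. 2)] -/
theorem theorem1_ii (m : ℕ) : xi (2 * m + 1) = ∑ h ∈ Finset.range (m + 1), xi (2 * h) * xi (2 * m - 2 * h) := by
  have hrange : ∑ h ∈ Finset.range (m + 1), xi (2 * h) * xi (2 * m - 2 * h) =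
      ∑ p ∈ antidiagonal m, xi (2 * p.1) * xi (2 * p.2) := by
    rw [Nat.sum_antidiagonal_eq_sum_range_succ_mk]
    refine sum_congr rfl fun h hh => ?_
    have : 2 * m - 2 * h = 2 * (m - h) := by omega
    rw [this]
  rw [hrange]
  have hterm : ∀ p ∈ antidiagonal m, xi (2 * p.1) * xi (2 * p.2) =
      π ^ (2 * m) * (oddOverEven p.1 / (2 * p.1 + 1) * (oddOverEven p.2 / (2 * p.2 + 1))) := by
    intro p hp
    have hsum := mem_antidiagonal.mp hp
    rw [xi_even_eq, xi_even_eq, ← hsum, show 2 * (p.1 + p.2) = 2 * p.1 + 2 * p.2 by ring, pow_add]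
    ring
  rw [sum_congr rfl hterm, ← mul_sum, sum_antidiagonal_evenCoeff_mul, xi_odd_eq]
  ring

/-- The even coefficients are summable against a geometric weight: `Σ (P_k/(2k+1)) u^k`, `0 ≤ u < 1`.
[cite: Tosi2026, Theorem 1 (p. 2)] -/
theorem summable_evenCoeff_mul_pow {u : ℝ} (hu0 : 0 ≤ u) (hu1 : u < 1) :
    Summable fun k : ℕ => oddOverEven k / (2 * k + 1) * u ^ k := by
  refine Summable.of_nonneg_of_le (fun k => ?_) (fun k => ?_) (summable_geometric_of_lt_one hu0 hu1)
  · exact mul_nonneg (div_nonneg (oddOverEven_pos k).le (by positivity)) (pow_nonneg hu0 k)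
  · have h1 : oddOverEven k / (2 * k + 1) ≤ 1 := by
      rw [div_le_one (by positivity)]
      linarith [oddOverEven_le_one k, show (0 : ℝ) ≤ 2 * k from by positivity]
    exact mul_le_of_le_one_left (pow_nonneg hu0 k) h1

/-- `binom(2m+2, m+1) · ((m+1)!)² = (2m+2)!` (cast to `ℝ`). [cite: Tosi2026, Theorem 1 (p. 2)] -/
theorem centralBinom_succ_mul_factorial_sq (m : ℕ) :
    ((m + 1).centralBinom : ℝ) * (Nat.factorial (m + 1) : ℝ) ^ 2 = (Nat.factorial (2 * m + 2) : ℝ) := by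
  have h := Nat.choose_mul_factorial_mul_factorial (show m + 1 ≤ 2 * (m + 1) by omega)
  rw [show 2 * (m + 1) - (m + 1) = m + 1 by omega, ← Nat.centralBinom_eq_two_mul_choose] at h
  rw [show 2 * m + 2 = 2 * (m + 1) by ring, ← h]
  push_cast
  ring

/-- **The even generating function**: for `0 < y < 1`, `Σ_{k≥0} (P_k/(2k+1)) y^{2k} = arcsin(y)/y`
(from (ii), i.e. `E² = O`, and Euler's `arcsin²` series for the odd generating function `O`).
[cite: Tosi2026, Theorem 1 (p. 2)] -/
theorem hasSum_evenCoeff (y : ℝ) (hy0 : 0 < y) (hy1 : y < 1) :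
    HasSum (fun k : ℕ => oddOverEven k / (2 * k + 1) * (y ^ 2) ^ k) (Real.arcsin y / y) := by
  set u := y ^ 2 with hu
  have hu0 : 0 ≤ u := sq_nonneg y
  have hupos : 0 < u := by positivity
  have hu1 : u < 1 := by rw [hu]; nlinarith
  have hsum : Summable fun k : ℕ => oddOverEven k / (2 * k + 1) * u ^ k := summable_evenCoeff_mul_pow hu0 hu1
  have hnn : ∀ k : ℕ, 0 ≤ oddOverEven k / (2 * k + 1) * u ^ k := fun k =>
    mul_nonneg (div_nonneg (oddOverEven_pos k).le (by positivity)) (pow_nonneg hu0 k)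
  have hnorm : Summable fun k : ℕ => ‖oddOverEven k / (2 * k + 1) * u ^ k‖ :=
    hsum.congr fun k => by rw [Real.norm_eq_abs, abs_of_nonneg (hnn k)]
  set E := ∑' k : ℕ, oddOverEven k / (2 * k + 1) * u ^ k with hE
  -- `E² = Σ_m (Σ_{i+j=m} c_i c_j) u^m = Σ_m (Q_m/(m+1)) u^m`
  have hE2 : E ^ 2 = ∑' m : ℕ, evenOverOdd m / (m + 1) * u ^ m := by
    rw [sq, hE, tsum_mul_tsum_eq_tsum_sum_antidiagonal_of_summable_norm hnorm hnorm]
    refine tsum_congr fun m => ?_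
    rw [← sum_antidiagonal_evenCoeff_mul, sum_mul]
    refine sum_congr rfl fun p hp => ?_
    have hij := mem_antidiagonal.mp hp
    rw [← hij, pow_add]
    ring
  -- Euler: `2 arcsin² y = Σ_{n≥1} 4ⁿ y^{2n}/(n² binom(2n,n))`, shifted and divided by `2u`
  have habs : |y| < 1 := by rw [abs_of_pos hy0]; exact hy1
  set f : ℕ → ℝ := fun n => (4 : ℝ) ^ n / ((n : ℝ) ^ 2 * n.centralBinom) * y ^ (2 * n) with hf
  have heuler : HasSum f (2 * Real.arcsin y ^ 2) := hasSum_arcsin_sq habs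
  have hshift := (hasSum_nat_add_iff' 1).mpr heuler
  have hf0 : ∑ i ∈ range 1, f i = 0 := by simp [hf]
  rw [hf0, sub_zero] at hshift
  have hcoef : ∀ m : ℕ, evenOverOdd m / (m + 1) * u ^ m = f (m + 1) / (2 * u) := by
    intro m
    simp only [hf]
    rw [evenOverOdd_eq_factorial, hu, ← pow_mul]
    have hC := centralBinom_succ_mul_factorial_sq m
    have hC' : ((m + 1).centralBinom : ℝ) = (Nat.factorial (2 * m + 2) : ℝ) / (Nat.factorial (m + 1) : ℝ) ^ 2 := by
      rw [← hC]
      have : ((Nat.factorial (m + 1) : ℕ) : ℝ) ≠ 0 := by positivity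
      field_simp
    rw [hC', show 2 * m + 2 = 2 * m + 1 + 1 by ring, Nat.factorial_succ (2 * m + 1), Nat.factorial_succ m]
    push_cast
    have h1 : ((Nat.factorial (2 * m + 1) : ℕ) : ℝ) ≠ 0 := by positivity
    have h2 : ((Nat.factorial m : ℕ) : ℝ) ≠ 0 := by positivity
    have h3 : y ≠ 0 := hy0.ne'
    field_simp
    ring
  have hO : HasSum (fun m : ℕ => evenOverOdd m / (m + 1) * u ^ m) (Real.arcsin y ^ 2 / u) := by
    have h2 := hshift.div_const (2 * u)
    have h3 : 2 * Real.arcsin y ^ 2 / (2 * u) = Real.arcsin y ^ 2 / u := mul_div_mul_left _ _ two_ne_zero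
    rw [h3] at h2
    have e : (fun m : ℕ => evenOverOdd m / (m + 1) * u ^ m) = fun m => f (m + 1) / (2 * u) := funext hcoef
    rw [e]
    exact h2
  -- conclude `E = arcsin y / y`
  have hEsq : E ^ 2 = (Real.arcsin y / y) ^ 2 := by
    rw [hE2, hO.tsum_eq, div_pow, hu]
  have hE0 : 0 ≤ E := tsum_nonneg hnn
  have hA0 : 0 ≤ Real.arcsin y / y := div_nonneg (Real.arcsin_nonneg.mpr hy0.le) hy0.le
  have hEeq : E = Real.arcsin y / y := (pow_left_inj₀ hE0 hA0 two_ne_zero).mp hEsq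
  rw [← hEeq]
  exact hsum.hasSum

/-- **Theorem 1 (i)**: `Σ_{n≥1} ξ_{2n} tⁿ = arcsin(π√t)/(π√t) − 1` for `0 < t < π⁻²`.
[cite: Tosi2026, Theorem 1 (p. 2)] -/
theorem theorem1_i (t : ℝ) (ht0 : 0 < t) (ht1 : t < 1 / Real.pi ^ 2) :
    HasSum (fun n : ℕ => xi (2 * (n + 1)) * t ^ (n + 1))
      (Real.arcsin (Real.pi * Real.sqrt t) / (Real.pi * Real.sqrt t) - 1) := by
  set y := Real.pi * Real.sqrt t with hy
  have hy0 : 0 < y := mul_pos Real.pi_pos (Real.sqrt_pos.mpr ht0)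
  have hysq : y ^ 2 = Real.pi ^ 2 * t := by
    rw [hy, mul_pow, Real.sq_sqrt ht0.le]
  have hy1 : y < 1 := by
    have h1 : Real.pi ^ 2 * t < 1 := by
      rw [lt_div_iff₀ (by positivity)] at ht1; linarith
    nlinarith
  have h := (hasSum_nat_add_iff' 1).mpr (hasSum_evenCoeff y hy0 hy1)
  have h0 : ∑ i ∈ range 1, oddOverEven i / (2 * (i : ℕ) + 1) * (y ^ 2) ^ i = (1 : ℝ) := by simp
  rw [h0] at h
  refine h.congr_fun fun n => ?_
  rw [xi_even_eq, hysq]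
  push_cast
  ring

/-- **Tosi 2026, Theorem 1 — the named fact `theorem1` DISCHARGED.** [cite: Tosi2026, Theorem 1 (p. 2)] -/
theorem theorem1_holds : Tosi2026.theorem1 :=
  ⟨theorem1_i, fun m _ => theorem1_ii m, theorem1_iii⟩

end Literature.NumberTheory.Irrationality.Tosi2026
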